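import Summits.QuantumFields.QCD.Theorems.HeatSlicedQuarksQuarkLoopCoefficientHeatSeries
import Literature.MathematicalPhysics.QuantumLattice.GrassmannIntegralProofs
import Summits.QuantumFields.QCD.Theorems.HeatSlicedQuarksQuarkLoopCoefficientFreeHeatCalculusAux

/-!
# Free heat calculus on `ℤ⁴`, part C: the free `D♯D` kernel is scalar in spin
(line `Sketch` of crux stmt-QuantumFields-16786, helper file of the stub `stub_freeHeatCalculus`)

For the trivial link field `u ≡ 1`, the squared Wilson–Dirac kernel is `sqKer 1 x y = ĥ(y − x) • 1`
with the Fourier coefficients `hhat` of the free symbol: the `γ`-matrices cancel in the linear terms,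
`(1 ∓ γ)(1 ± γ) = 0` kills the `±2e_μ` coefficients, and the mixed terms symmetrise to anticommutators
(Clifford relations `euclideanGamma_anticomm_holds`).
-/

noncomputable section

namespace Summit.QuantumFields.QCD.Cruxes.QuarkLoopCoefficient.Sketch.FreeHeatCalculus

open Literature.MathematicalPhysics.QuantumLattice Literature.MathematicalPhysics.QuantumFieldTheory
open Literature.Probability.LatticeModels (Site)
open Summit.QuantumFields.QCD.Theorems.QuarkLoopCoefficient
open Summit.QuantumFields.QCD.Cruxes.QuarkLoopCoefficient.Sketch.HeatSeries
open scoped Matrix ComplexConjugate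

/-! ## The free Dirac kernel -/

/-- The free Dirac kernel with all conditions solved for the column index:
`D(x', y) = 4[y = x'] − ½ Σ_ν ([y = x' + e_ν](1 − γ_ν) + [y = x' − e_ν](1 + γ_ν))`. -/
theorem diracKer_one_apply (x' y : Site 4) :
    diracKer (fun _ => (1 : ℂ)) x' y =
      (if y = x' then (4 : ℂ) • (1 : Spin) else 0) -
        (1 / 2 : ℂ) • ∑ ν : Fin 4,
          ((if y = x' + Pi.single ν 1 then ((1 : Spin) - euclideanGamma ν) else 0) +
            (if y = x' - Pi.single ν 1 then ((1 : Spin) + euclideanGamma ν) else 0)) := by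
  unfold diracKer
  have hc1 : (x' = y) = (y = x') := propext eq_comm
  have hc2 : ∀ ν : Fin 4, (x' = y + Pi.single ν 1) = (y = x' - Pi.single ν 1) := fun ν =>
    propext ⟨fun h => by rw [h, add_sub_cancel_right], fun h => by rw [h, sub_add_cancel]⟩
  simp only [one_smul, map_one, hc1, hc2]

/-- The free Dirac kernel matrix `D(z, x)` is Hermitian as a spin matrix. -/
theorem conjTranspose_diracKer_one (z x : Site 4) :
    (diracKer (fun _ => (1 : ℂ)) z x)ᴴ = diracKer (fun _ => (1 : ℂ)) z x := by
  have hγ : ∀ μ : Fin 4, (euclideanGamma μ)ᴴ = euclideanGamma μ := fun μ =>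
    (euclideanGamma_isHermitian μ).eq
  rw [diracKer_one_apply, Matrix.conjTranspose_sub, Matrix.conjTranspose_smul,
    Matrix.conjTranspose_sum]
  have h2 : star (1 / 2 : ℂ) = 1 / 2 := by
    rw [Complex.star_def, map_div₀, map_one, map_ofNat]
  rw [h2]
  congr 1
  · split_ifs
    · rw [Matrix.conjTranspose_smul, Matrix.conjTranspose_one, Complex.star_def, map_ofNat]
    · rw [Matrix.conjTranspose_zero]
  · congr 1
    refine Finset.sum_congr rfl fun ν _ => ?_
    rw [Matrix.conjTranspose_add]
    congr 1
    · split_ifs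
      · rw [Matrix.conjTranspose_sub, Matrix.conjTranspose_one, hγ]
      · rw [Matrix.conjTranspose_zero]
    · split_ifs
      · rw [Matrix.conjTranspose_add, Matrix.conjTranspose_one, hγ]
      · rw [Matrix.conjTranspose_zero]

/-- The free squared kernel after summing out the intermediate site:
`H(x,y) = 4 D(x,y) − ½ Σ_μ ((1 − γ_μ) D(x − e_μ, y) + (1 + γ_μ) D(x + e_μ, y))`. -/
theorem sqKer_one_eq (x y : Site 4) :
    sqKer (fun _ => (1 : ℂ)) x y =
      (4 : ℂ) • diracKer (fun _ => (1 : ℂ)) x y -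
        (1 / 2 : ℂ) • ∑ μ : Fin 4,
          (((1 : Spin) - euclideanGamma μ) * diracKer (fun _ => (1 : ℂ)) (x - Pi.single μ 1) y +
            ((1 : Spin) + euclideanGamma μ) * diracKer (fun _ => (1 : ℂ)) (x + Pi.single μ 1) y) := by
  unfold sqKer
  simp_rw [conjTranspose_diracKer_one]
  -- expand `D(z, x)` with conditions solved for `z`
  have hD : ∀ z : Site 4, diracKer (fun _ => (1 : ℂ)) z x * diracKer (fun _ => (1 : ℂ)) z y =
      (if z = x then (4 : ℂ) • diracKer (fun _ => (1 : ℂ)) z y else 0) -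
        (1 / 2 : ℂ) • ∑ μ : Fin 4,
          ((if z = x - Pi.single μ 1 then ((1 : Spin) - euclideanGamma μ) * diracKer (fun _ => (1 : ℂ)) z y
              else 0) +
            (if z = x + Pi.single μ 1 then ((1 : Spin) + euclideanGamma μ) * diracKer (fun _ => (1 : ℂ)) z y
              else 0)) := by
    intro z
    rw [diracKer_one_apply z x]
    have hc1 : (x = z) = (z = x) := propext eq_comm
    have hc2 : ∀ μ : Fin 4, (x = z + Pi.single μ 1) = (z = x - Pi.single μ 1) := fun μ =>
      propext ⟨fun h => by rw [h, add_sub_cancel_right], fun h => by rw [h, sub_add_cancel]⟩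
    have hc3 : ∀ μ : Fin 4, (x = z - Pi.single μ 1) = (z = x + Pi.single μ 1) := fun μ =>
      propext ⟨fun h => by rw [h, sub_add_cancel], fun h => by rw [h, add_sub_cancel_right]⟩
    simp only [hc1, hc2, hc3, sub_mul, Matrix.smul_mul, Finset.sum_mul, add_mul, ite_mul, zero_mul,
      Matrix.one_mul]
  rw [Finset.sum_congr rfl fun z _ => hD z, Finset.sum_sub_distrib, ← Finset.smul_sum,
    Finset.sum_ite_eq_of_mem' _ _ _ (self_mem_nbr _), Finset.sum_comm]
  congr 2
  refine Finset.sum_congr rfl fun μ _ => ?_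
  rw [Finset.sum_add_distrib, Finset.sum_ite_eq_of_mem' _ _ _ (sub_single_mem_nbr _ _),
    Finset.sum_ite_eq_of_mem' _ _ _ (add_single_mem_nbr _ _)]

/-- A conditional matrix is the indicator scalar times the matrix. -/
theorem ite_eq_indicator_smul (c : Prop) [Decidable c] (M : Spin) :
    (if c then M else 0) = (if c then (1 : ℂ) else 0) • M := by
  split_ifs <;> simp

/-- `e₀` as a vector literal. -/
theorem single_zero_eq : (Pi.single (0 : Fin 4) (1 : ℤ) : Site 4) = ![1, 0, 0, 0] := by
  funext i; fin_cases i <;> rfl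

/-- `e₁` as a vector literal. -/
theorem single_one_eq : (Pi.single (1 : Fin 4) (1 : ℤ) : Site 4) = ![0, 1, 0, 0] := by
  funext i; fin_cases i <;> rfl

/-- `e₂` as a vector literal. -/
theorem single_two_eq : (Pi.single (2 : Fin 4) (1 : ℤ) : Site 4) = ![0, 0, 1, 0] := by
  funext i; fin_cases i <;> rfl

/-- `e₃` as a vector literal. -/
theorem single_three_eq : (Pi.single (3 : Fin 4) (1 : ℤ) : Site 4) = ![0, 0, 0, 1] := by
  funext i; fin_cases i <;> rfl

/-- The zero vector literal. -/
theorem vec_zero_eq : (![0, 0, 0, 0] : Site 4) = 0 := by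
  funext i; fin_cases i <;> rfl

/-- Casting a real indicator to `ℂ`. -/
theorem ofReal_indicator (c : Prop) [Decidable c] :
    (((if c then (1 : ℝ) else 0) : ℝ) : ℂ) = if c then (1 : ℂ) else 0 := by
  split_ifs <;> simp

/-- Clifford reordering rules `γ_j γ_i = −γ_i γ_j` for `i < j`. -/
theorem gamma_swap_10 : euclideanGamma 1 * euclideanGamma 0 = -(euclideanGamma 0 * euclideanGamma 1) :=
  euclideanGamma_mul_of_ne (by decide)

/-- Clifford reordering rule. -/
theorem gamma_swap_20 : euclideanGamma 2 * euclideanGamma 0 = -(euclideanGamma 0 * euclideanGamma 2) :=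
  euclideanGamma_mul_of_ne (by decide)

/-- Clifford reordering rule. -/
theorem gamma_swap_30 : euclideanGamma 3 * euclideanGamma 0 = -(euclideanGamma 0 * euclideanGamma 3) :=
  euclideanGamma_mul_of_ne (by decide)

/-- Clifford reordering rule. -/
theorem gamma_swap_21 : euclideanGamma 2 * euclideanGamma 1 = -(euclideanGamma 1 * euclideanGamma 2) :=
  euclideanGamma_mul_of_ne (by decide)

/-- Clifford reordering rule. -/
theorem gamma_swap_31 : euclideanGamma 3 * euclideanGamma 1 = -(euclideanGamma 1 * euclideanGamma 3) :=
  euclideanGamma_mul_of_ne (by decide)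

/-- Clifford reordering rule. -/
theorem gamma_swap_32 : euclideanGamma 3 * euclideanGamma 2 = -(euclideanGamma 2 * euclideanGamma 3) :=
  euclideanGamma_mul_of_ne (by decide)

/-- **The free `D♯D` kernel is scalar in spin**: `sqKer 1 x y = ĥ(y − x) • 1` (conjunct (1) of
`FreeHeatCalculus`).  Brute force: all sums over `Fin 4` are expanded, the `81` displacement vectors are
normalised to vector literals (so that equal displacements become syntactically equal indicators), the
`γ`-products are Clifford-ordered, and `module` compares coefficients. -/
theorem sqKer_one (x y : Site 4) :
    sqKer (fun _ => (1 : ℂ)) x y = ((hhat (y - x) : ℝ) : ℂ) • (1 : Spin) := by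
  rw [sqKer_one_eq, hhat_eq_indicator]
  simp only [diracKer_one_apply, ite_eq_indicator_smul]
  simp only [Fin.sum_univ_four, Fin.isValue, Fin.reduceEq, if_true, if_false]
  push_cast
  simp only [ofReal_indicator, sub_eq_iff_eq_add', add_zero]
  have hsub : ∀ a b : Site 4, a - b = a + -b := fun a b => sub_eq_add_neg a b
  simp only [hsub, single_zero_eq, single_one_eq, single_two_eq, single_three_eq, Matrix.neg_cons,
    Matrix.neg_empty, Matrix.cons_add_cons, Matrix.empty_add_empty, add_assoc, neg_zero, add_zero, zero_add,
    add_neg_cancel, neg_add_cancel, Int.reduceAdd, Int.reduceNeg, vec_zero_eq]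
  simp only [mul_sub, mul_add, sub_mul, add_mul, Matrix.mul_smul, one_mul, mul_one, euclideanGamma_mul_self, gamma_swap_10, gamma_swap_20, gamma_swap_30, gamma_swap_21,
    gamma_swap_31, gamma_swap_32]
  module

/-! ## Registered headline -/

/-- Registered headline of this helper file (aux stub `stub_freeHeatCalculusAuxC` of crux
stmt-QuantumFields-16786, line `Sketch`): the free squared Wilson–Dirac kernel is `ĥ • 1`. -/
theorem stub_freeHeatCalculusAuxC :
    ∀ x y : Site 4, sqKer (fun _ => (1 : ℂ)) x y = ((hhat (y - x) : ℝ) : ℂ) • (1 : Spin) :=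
  sqKer_one

end Summit.QuantumFields.QCD.Cruxes.QuarkLoopCoefficient.Sketch.FreeHeatCalculus

end
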